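import Literature.Computability.AlgebraicComplexity.BI17MinimalDegreeTwentyThreeIff
import Literature.Computability.AlgebraicComplexity.KronRectThirteenSixChecks1
import Literature.Computability.AlgebraicComplexity.KronRectThirteenSixChecks2
import Literature.Computability.AlgebraicComplexity.KronRectThirteenSixChecks3
import Literature.Computability.AlgebraicComplexity.KronRectThirteenSixChecks4
import Literature.Computability.AlgebraicComplexity.KronRectThirteenSixChecks5
import Literature.Computability.AlgebraicComplexity.KronRectThirteenSixChecks6
import Literature.Computability.AlgebraicComplexity.KronRectThirteenSixChecks7
import Literature.Computability.AlgebraicComplexity.KronRectThirteenSixChecks8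
import HarnessLib

/-!
# `k_13(6) > 0` by a memoised block-sign design certificate — assembly (theorem-only): all chunks, the key check, `k_13(6) > 0`, and BI 2017 Problem 5.19's `e(23) = 138`

Bürgisser–Ikenmeyer 2017 §5 (Ex. 5.6, Problem 5.19) [BurgisserIkenmeyer2017] / Amanov–Yeliussizov 2022 §8
(Thm. 8.4 (ii), Cor. 8.5) [AmanovYeliussizov2022]: `k_m(δ) = g(m×δ,m×δ,m×δ) > 0` as soon as some magic
set `T ⊆ [δ]³` with `m` cells on every axis plane has a nonzero normalised signed count of resolutions
into diagonals. The design here (78 cells, 541 diagonals) is `C_0 ⊔ C_1 ⊔ D` with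
`C_r = {(x,y,z) : x + y + 2z ≡ r (mod 6)}` (two affine classes without mixed diagonals) and one more
diagonal `D`; its count is `-414`, computed in the kernel by the memoised evaluator of
`AC/KronRectDesignDAG.lean` (2274 shared states, 8 check chunks; cell `val-lit`, seat t04 g9).
Honest framing: BI 2017 §5 / AY 2022 §8 invariant-degree bookkeeping; nothing here bears on VP versus VNP.

## References
* [BurgisserIkenmeyer2017] P. Bürgisser, C. Ikenmeyer, J. Algebra 477 (2017), §5, Ex. 5.6, Problem 5.19.
* [AmanovYeliussizov2022] A. Amanov, D. Yeliussizov, IMRN 2023 = arXiv:2202.11059, Thm. 8.4, Cor. 8.5.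
-/

set_option Elab.async false
set_option maxRecDepth 200000

namespace Literature.Computability.AlgebraicComplexity

namespace KronRectThirteenSix

open DesignDAG
/-- All entry checks pass: the eight kernel-checked chunks `hC1 … hC8`, concatenated.
[cite: AmanovYeliussizov2022, Thm. 8.4 (ii)] -/
theorem hE : checkEntries 78 rows dg tab (E1 ++ E2 ++ E3 ++ E4 ++ E5 ++ E6 ++ E7 ++ E8) = true := by
  have h1 : E1.all (checkEntry 78 rows dg tab) = true := hC1
  have h2 : E2.all (checkEntry 78 rows dg tab) = true := hC2
  have h3 : E3.all (checkEntry 78 rows dg tab) = true := hC3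
  have h4 : E4.all (checkEntry 78 rows dg tab) = true := hC4
  have h5 : E5.all (checkEntry 78 rows dg tab) = true := hC5
  have h6 : E6.all (checkEntry 78 rows dg tab) = true := hC6
  have h7 : E7.all (checkEntry 78 rows dg tab) = true := hC7
  have h8 : E8.all (checkEntry 78 rows dg tab) = true := hC8
  simp only [checkEntries, List.all_append, h1, h2, h3, h4, h5, h6, h7, h8, Bool.and_true]

set_option maxHeartbeats 100000000 in
/-- The keys of the table of shared values are exactly the checked entries, in order (kernel check), so
every table lookup made by the evaluator is justified by a checked entry.
[cite: AmanovYeliussizov2022, Thm. 8.4 (ii)] -/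
theorem hkeys : tab.keys = (E1 ++ E2 ++ E3 ++ E4 ++ E5 ++ E6 ++ E7 ++ E8).map Prod.fst := by
  decide +kernel

end KronRectThirteenSix

/-- **`k_13(6) > 0`**: the Kronecker coefficient of three `13 × 6` rectangles is positive, for every field
of characteristic zero — by the memoised block-sign design certificate (signed count `-414`).
[cite: BurgisserIkenmeyer2017, Thm. 5.9 and Problem 5.19] [cite: AmanovYeliussizov2022, Thm. 8.4 and Cor. 8.5] -/
theorem kronRect_thirteen_six_pos (k : Type*) [Field k] [CharZero k] :
    0 < kronRect k 13 6 :=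
  DesignDAG.kronRect_pos_of_checkEntries k (by decide) KronRectThirteenSix.e₁ KronRectThirteenSix.e₂ KronRectThirteenSix.e₃ KronRectThirteenSix.hAD KronRectThirteenSix.hT KronRectThirteenSix.hE
    KronRectThirteenSix.hkeys KronRectThirteenSix.hroot (by decide)

/-- **`k_23(6) > 0`** (complement symmetry `13 + 23 = 6²`). [cite: BurgisserIkenmeyer2017, §5 eq. (5.2)] -/
theorem kronRect_twentyThree_six_pos : 0 < kronRect ℂ 23 6 :=
  kronRect_twentyThree_six_pos_iff.2 (kronRect_thirteen_six_pos ℂ)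

/-- **`e(23) = 138`**: the minimal degree of a nonzero `SL_23³`-invariant not vanishing on generic tensors
of format `23 × 23 × 23` is `138 = 23 · 6` — the second odd anomaly `m = δ² - 2` of Bürgisser–Ikenmeyer's
table (Problem 5.19; `e(7) = 28` is the first), settled by `k_13(6) > 0` and the tree's reduction
`genericTensorMinimalDegree_twentyThree_iff`. In print only the lower bound is proved: `δ₃(n) ≥ n⌈√n⌉ + n`
for odd `n = k² - 2` (Amanov–Yeliussizov 2022, after Thm. 1.1, from `g₃(2,k) = g₃(k² - 2, k) = 0` for odd
`k`), and equality is CONJECTURED there (§1: "the only exceptional cases `d = 3` and odd `n = k² - 2`, for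
which it is larger by `n`"; §5 after Cor. 5.5: `g₃(n,k) > 0` for even `k`); the case `n = 23` of that
conjecture is settled here by a kernel computation. [cite: BurgisserIkenmeyer2017, Problem 5.19]
[cite: AmanovYeliussizov2022, Thm. 1.1 and §5 (conjecture after Cor. 5.5)] -/
theorem genericTensorMinimalDegree_twentyThree : genericTensorMinimalDegree (Fin 23) ℂ = 138 :=
  genericTensorMinimalDegree_twentyThree_of (kronRect_thirteen_six_pos ℂ)

/-- `78 ∈ E(13)` and `138 ∈ E(23)`. [cite: BurgisserIkenmeyer2017, §5 eq. (5.2) and Ex. 5.6] -/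
theorem mem_genericTensorDegreeMonoid_seventyEight_thirteen :
    78 ∈ genericTensorDegreeMonoid (Fin 13) ℂ ∧ 138 ∈ genericTensorDegreeMonoid (Fin 23) ℂ := by
  have h13 : 78 ∈ genericTensorDegreeMonoid (Fin 13) ℂ := by
    rw [genericTensorDegreeMonoid_eq_kronRect 13]
    exact ⟨6, rfl, kronRect_thirteen_six_pos ℂ⟩
  exact ⟨h13, mem_genericTensorDegreeMonoid_thirteen_iff_twentyThree.1 h13⟩

end Literature.Computability.AlgebraicComplexity
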